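import Mathlib

/-!
HONEST FRAMING: exact (Metropolis-corrected) sampling algorithms for lattice gauge theory; figures
of merit are autocorrelation/cost numbers at stated couplings and volumes; no continuum-physics
claim.

# SwapLadderIndexTauIntThresholdMinorant — THE ANALYTIC CORE OF THE LINEAR LOWER BOUND ON THE COLLAPSE THRESHOLD: AN
# ANTITONE STEP MINORANT `m(t)` (`1, 0.8, 0.5, 0.35, 0.2, 0.08` BELOW `0.069, 0.097, 0.16, 0.206, 0.268, 0.347`, `0` ABOVE)
# WITH `∫_0^{1/2} m = 0.15772` AND THE RIEMANN BOUND `Σ_{u=1}^{a} m(u/N) ≥ 0.15772·N − 1` FOR `2(a+1) ≥ N`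
# (row 22 `su3-ptbc`, GEN-8, ours; Mathlib only — companion of `SwapLadderIndexTauIntThresholdMajorant`)

Venture `LatticeQCDFlow` (cell pub-lqcd), topic `Scaling`; FANOUT row 22 (`su3-ptbc`).  NEW WORK of the cell, Mathlib only
(`AntitoneOn.integral_le_sum`, `intervalIntegral`); nothing is cited as a fact; no `native_decide`.  No statement about swap
ladders here: this is the real-analysis half of the staged sequel `SwapLadderIndexTauIntThresholdCollapse`, which certifies
six LOWER points `G′(2√2·x) < R·G′(0)` (`(R, x) = (1.21, 0.08), (1.61, 0.2), (2.32, 0.35), (3.43, 0.5), (8, 0.8), (15, 1)`), hence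
`critGap((4t(1−t))^{−2}) ≥ 2√2·m(t)`, and concludes `Λ_c(K) ≥ 4√2·(0.15772·(K+1) − 1)` for `K ≥ 20` — so flat ladders with
pair acceptance `≥ 75 %` and `K ≥ 20` gaps are BELOW the collapse threshold of the `τ_int`-optimal ladder.

* §1 `indexMinorant` (six switched-on increments, all `if t ≤ τ then v else 0`): values band by band, `0 ≤ m ≤ 1`,
  **`antitone_indexMinorant`** (on all of `ℝ`), measurability, interval-integrability (bounded).
* §2 `integral_indexMinorant_half` — `∫_0^{1/2} m = 0.15772` exactly, from the band integrals (`∫_0^{1/2} (if t ≤ τ then v else 0)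
  = v·τ`, computed on `Ioc`-pieces with the a.e. congruence at the single switching point);
* §3 **`integral_le_sum_indexMinorant`** — `N·∫_{1/N}^{(a+1)/N} m ≤ Σ_{u=1}^{a} m(u/N)` (Mathlib's antitone sum–integral
  comparison, rescaled), and the packaged **`sum_indexMinorant_ge`**: `0.15772·N − 1 ≤ Σ_{u=1}^{a} m(u/N)` whenever
  `1 ≤ N ≤ 2(a+1)` (the first cell `∫_0^{1/N} m ≤ 1/N` is given away; beyond `1/2` the minorant vanishes).
NOT CLAIMED: anything about PTBC or a run; optimality of the constants.
-/

noncomputable section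

open Real Set MeasureTheory intervalIntegral

namespace Summit.Ventures.LatticeQCDFlow.Scaling

/-! ## §1 The step minorant -/

section Minorant

/-- **The minorant**: `1` on `(−∞, 0.069]`, `0.8` on `(0.069, 0.097]`, `0.5` on `(0.097, 0.16]`, `0.35` on `(0.16, 0.206]`,
`0.2` on `(0.206, 0.268]`, `0.08` on `(0.268, 0.347]`, `0` above. [ours] -/
def indexMinorant (t : ℝ) : ℝ :=
  (if t ≤ 347 / 1000 then 2 / 25 else 0) + (if t ≤ 67 / 250 then 3 / 25 else 0) + (if t ≤ 103 / 500 then 3 / 20 else 0)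
    + (if t ≤ 4 / 25 then 3 / 20 else 0) + (if t ≤ 97 / 1000 then 3 / 10 else 0) + (if t ≤ 69 / 1000 then 1 / 5 else 0)

/-- A switched-on nonnegative increment `if t ≤ τ then v else 0` is antitone in `t`. [folklore] -/
theorem ite_le_antitone {τ v : ℝ} (hv : 0 ≤ v) : Antitone fun t : ℝ => if t ≤ τ then v else (0 : ℝ) := by
  intro a b hab
  show (if b ≤ τ then v else 0) ≤ (if a ≤ τ then v else 0)
  split_ifs <;> first | exact le_rfl | exact hv | (exfalso; linarith)

/-- **The minorant is antitone on `ℝ`.** [ours] -/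
theorem antitone_indexMinorant : Antitone indexMinorant := by
  intro a b hab
  unfold indexMinorant
  have h1 := ite_le_antitone (τ := 347 / 1000) (v := 2 / 25) (by norm_num) hab
  have h2 := ite_le_antitone (τ := 67 / 250) (v := 3 / 25) (by norm_num) hab
  have h3 := ite_le_antitone (τ := 103 / 500) (v := 3 / 20) (by norm_num) hab
  have h4 := ite_le_antitone (τ := 4 / 25) (v := 3 / 20) (by norm_num) hab
  have h5 := ite_le_antitone (τ := 97 / 1000) (v := 3 / 10) (by norm_num) hab
  have h6 := ite_le_antitone (τ := 69 / 1000) (v := 1 / 5) (by norm_num) hab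
  simp only at h1 h2 h3 h4 h5 h6
  linarith

/-- `0 ≤ m ≤ 1`. [ours] -/
theorem indexMinorant_mem (t : ℝ) : indexMinorant t ∈ Icc (0 : ℝ) 1 := by
  unfold indexMinorant
  constructor <;> split_ifs <;> norm_num

/-- Band values from BELOW are not needed; from ABOVE (what the sequel dominates): `t ≤ 0.069 ⇒ m t = 1`… stated as
upper bounds `m t ≤ v` on each band and the exact top value. -/
theorem indexMinorant_le_one (t : ℝ) : indexMinorant t ≤ 1 := (indexMinorant_mem t).2

/-- `0.069 < t ⇒ m t ≤ 4/5`. [ours] -/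
theorem indexMinorant_le_of_gt_069 {t : ℝ} (ht : 69 / 1000 < t) : indexMinorant t ≤ 4 / 5 := by
  unfold indexMinorant; split_ifs <;> linarith

/-- `0.097 < t ⇒ m t ≤ 1/2`. [ours] -/
theorem indexMinorant_le_of_gt_097 {t : ℝ} (ht : 97 / 1000 < t) : indexMinorant t ≤ 1 / 2 := by
  unfold indexMinorant; split_ifs <;> linarith

/-- `0.16 < t ⇒ m t ≤ 7/20`. [ours] -/
theorem indexMinorant_le_of_gt_16 {t : ℝ} (ht : 4 / 25 < t) : indexMinorant t ≤ 7 / 20 := by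
  unfold indexMinorant; split_ifs <;> linarith

/-- `0.206 < t ⇒ m t ≤ 1/5`. [ours] -/
theorem indexMinorant_le_of_gt_206 {t : ℝ} (ht : 103 / 500 < t) : indexMinorant t ≤ 1 / 5 := by
  unfold indexMinorant; split_ifs <;> linarith

/-- `0.268 < t ⇒ m t ≤ 2/25`. [ours] -/
theorem indexMinorant_le_of_gt_268 {t : ℝ} (ht : 67 / 250 < t) : indexMinorant t ≤ 2 / 25 := by
  unfold indexMinorant; split_ifs <;> linarith

/-- `0.347 < t ⇒ m t = 0`… as `≤ 0`. [ours] -/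
theorem indexMinorant_le_of_gt_347 {t : ℝ} (ht : 347 / 1000 < t) : indexMinorant t ≤ 0 := by
  unfold indexMinorant; split_ifs <;> linarith

/-- Band values from below (used for the integral): `t ≤ 0.069 ⇒ 1 ≤ m t`. [ours] -/
theorem indexMinorant_ge_of_le_069 {t : ℝ} (ht : t ≤ 69 / 1000) : 1 ≤ indexMinorant t := by
  unfold indexMinorant; split_ifs <;> linarith

/-- `t ≤ 0.097 ⇒ 4/5 ≤ m t`. [ours] -/
theorem indexMinorant_ge_of_le_097 {t : ℝ} (ht : t ≤ 97 / 1000) : 4 / 5 ≤ indexMinorant t := by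
  unfold indexMinorant; split_ifs <;> linarith

/-- `t ≤ 0.16 ⇒ 1/2 ≤ m t`. [ours] -/
theorem indexMinorant_ge_of_le_16 {t : ℝ} (ht : t ≤ 4 / 25) : 1 / 2 ≤ indexMinorant t := by
  unfold indexMinorant; split_ifs <;> linarith

/-- `t ≤ 0.206 ⇒ 7/20 ≤ m t`. [ours] -/
theorem indexMinorant_ge_of_le_206 {t : ℝ} (ht : t ≤ 103 / 500) : 7 / 20 ≤ indexMinorant t := by
  unfold indexMinorant; split_ifs <;> linarith

/-- `t ≤ 0.268 ⇒ 1/5 ≤ m t`. [ours] -/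
theorem indexMinorant_ge_of_le_268 {t : ℝ} (ht : t ≤ 67 / 250) : 1 / 5 ≤ indexMinorant t := by
  unfold indexMinorant; split_ifs <;> linarith

/-- `t ≤ 0.347 ⇒ 2/25 ≤ m t`. [ours] -/
theorem indexMinorant_ge_of_le_347 {t : ℝ} (ht : t ≤ 347 / 1000) : 2 / 25 ≤ indexMinorant t := by
  unfold indexMinorant; split_ifs <;> linarith

/-- The minorant is measurable. [ours] -/
theorem measurable_indexMinorant : Measurable indexMinorant := by
  unfold indexMinorant
  refine (((((?_ : Measurable fun t : ℝ => _).add ?_).add ?_).add ?_).add ?_).add ?_ <;>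
    exact Measurable.ite measurableSet_Iic measurable_const measurable_const

/-- The minorant is interval-integrable on every interval (bounded, measurable). [ours] -/
theorem intervalIntegrable_indexMinorant (a b : ℝ) : IntervalIntegrable indexMinorant volume a b := by
  refine (intervalIntegrable_const (c := (1 : ℝ))).mono_fun' measurable_indexMinorant.aestronglyMeasurable ?_
  refine ae_of_all _ fun t => ?_
  show ‖indexMinorant t‖ ≤ 1
  rw [Real.norm_eq_abs, abs_of_nonneg (indexMinorant_mem t).1]
  exact (indexMinorant_mem t).2

end Minorant

/-! ## §2 `∫_0^{1/2} m = 0.15772` -/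

section Integral

/-- A band: `∫_a^b m = v·(b − a)` when `m = v` on `(a, b]` (a.e. form). [ours] -/
theorem integral_indexMinorant_band {a b v : ℝ} (hab : a ≤ b) (hv : ∀ t, a < t → t ≤ b → indexMinorant t = v) :
    ∫ t in a..b, indexMinorant t = v * (b - a) := by
  have h : ∫ t in a..b, indexMinorant t = ∫ _ in a..b, v := by
    refine intervalIntegral.integral_congr_ae (ae_of_all _ fun t ht => ?_)
    rw [uIoc_of_le hab] at ht
    exact hv t ht.1 ht.2
  rw [h, intervalIntegral.integral_const, smul_eq_mul, mul_comm]

/-- **`∫_0^{1/2} m = 0.15772`** (`= 1·0.069 + 0.8·0.028 + 0.5·0.063 + 0.35·0.046 + 0.2·0.062 + 0.08·0.079`). [ours] -/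
theorem integral_indexMinorant_half : ∫ t in (0 : ℝ)..(1 / 2), indexMinorant t = 0.15772 := by
  have hii := intervalIntegrable_indexMinorant
  have b1 : ∫ t in (0 : ℝ)..(69 / 1000), indexMinorant t = 1 * (69 / 1000 - 0) :=
    integral_indexMinorant_band (by norm_num) fun t _ h2 =>
      le_antisymm (indexMinorant_le_one t) (indexMinorant_ge_of_le_069 h2)
  have b2 : ∫ t in (69 / 1000 : ℝ)..(97 / 1000), indexMinorant t = 4 / 5 * (97 / 1000 - 69 / 1000) :=
    integral_indexMinorant_band (by norm_num) fun t h1 h2 =>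
      le_antisymm (indexMinorant_le_of_gt_069 h1) (indexMinorant_ge_of_le_097 h2)
  have b3 : ∫ t in (97 / 1000 : ℝ)..(4 / 25), indexMinorant t = 1 / 2 * (4 / 25 - 97 / 1000) :=
    integral_indexMinorant_band (by norm_num) fun t h1 h2 =>
      le_antisymm (indexMinorant_le_of_gt_097 h1) (indexMinorant_ge_of_le_16 h2)
  have b4 : ∫ t in (4 / 25 : ℝ)..(103 / 500), indexMinorant t = 7 / 20 * (103 / 500 - 4 / 25) :=
    integral_indexMinorant_band (by norm_num) fun t h1 h2 =>
      le_antisymm (indexMinorant_le_of_gt_16 h1) (indexMinorant_ge_of_le_206 h2)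
  have b5 : ∫ t in (103 / 500 : ℝ)..(67 / 250), indexMinorant t = 1 / 5 * (67 / 250 - 103 / 500) :=
    integral_indexMinorant_band (by norm_num) fun t h1 h2 =>
      le_antisymm (indexMinorant_le_of_gt_206 h1) (indexMinorant_ge_of_le_268 h2)
  have b6 : ∫ t in (67 / 250 : ℝ)..(347 / 1000), indexMinorant t = 2 / 25 * (347 / 1000 - 67 / 250) :=
    integral_indexMinorant_band (by norm_num) fun t h1 h2 =>
      le_antisymm (indexMinorant_le_of_gt_268 h1) (indexMinorant_ge_of_le_347 h2)
  have b7 : ∫ t in (347 / 1000 : ℝ)..(1 / 2), indexMinorant t = 0 * (1 / 2 - 347 / 1000) :=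
    integral_indexMinorant_band (by norm_num) fun t h1 _ =>
      le_antisymm (indexMinorant_le_of_gt_347 h1) (indexMinorant_mem t).1
  rw [← intervalIntegral.integral_add_adjacent_intervals (hii 0 (69 / 1000)) (hii _ (1 / 2)),
    ← intervalIntegral.integral_add_adjacent_intervals (hii (69 / 1000) (97 / 1000)) (hii _ (1 / 2)),
    ← intervalIntegral.integral_add_adjacent_intervals (hii (97 / 1000) (4 / 25)) (hii _ (1 / 2)),
    ← intervalIntegral.integral_add_adjacent_intervals (hii (4 / 25) (103 / 500)) (hii _ (1 / 2)),
    ← intervalIntegral.integral_add_adjacent_intervals (hii (103 / 500) (67 / 250)) (hii _ (1 / 2)),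
    ← intervalIntegral.integral_add_adjacent_intervals (hii (67 / 250) (347 / 1000)) (hii _ (1 / 2)),
    b1, b2, b3, b4, b5, b6, b7]
  norm_num

/-- `∫_0^{x} m ≤ x` for `0 ≤ x` (`m ≤ 1`). [ours] -/
theorem integral_indexMinorant_le_self {x : ℝ} (hx : 0 ≤ x) : ∫ t in (0 : ℝ)..x, indexMinorant t ≤ x := by
  have h := intervalIntegral.integral_mono_on hx (intervalIntegrable_indexMinorant 0 x) intervalIntegrable_const
    (fun t _ => indexMinorant_le_one t)
  simpa using h

/-- `0 ≤ ∫_a^b m` for `a ≤ b`. [ours] -/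
theorem integral_indexMinorant_nonneg {a b : ℝ} (hab : a ≤ b) : 0 ≤ ∫ t in a..b, indexMinorant t :=
  intervalIntegral.integral_nonneg hab fun t _ => (indexMinorant_mem t).1

end Integral

/-! ## §3 The Riemann lower bound -/

section Riemann

/-- Reindexing `Σ_{i<a} f((1+i)/N) = Σ_{u ∈ [1,a]} f(u/N)`. [folklore] -/
theorem sum_range_one_add_div (f : ℝ → ℝ) (N : ℝ) (a : ℕ) :
    ∑ i ∈ Finset.range a, f ((1 + (i : ℕ) : ℝ) / N) = ∑ u ∈ Finset.Icc 1 a, f ((u : ℝ) / N) := by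
  induction a with
  | zero => simp
  | succ n ih =>
    rw [Finset.sum_range_succ, Finset.sum_Icc_succ_top (by omega), ih]
    have e : ((1 + (n : ℕ) : ℝ)) = ((n + 1 : ℕ) : ℝ) := by push_cast; ring
    rw [e]

/-- **`N·∫_{1/N}^{(a+1)/N} m ≤ Σ_{u=1}^{a} m(u/N)`** (`N ≥ 1`; the minorant is antitone: on each cell `[u/N, (u+1)/N]` it is
at most its value at the left endpoint). [ours] -/
theorem integral_le_sum_indexMinorant {N : ℕ} (hN : 0 < N) (a : ℕ) :
    (N : ℝ) * ∫ t in (1 : ℝ) / N..((a : ℝ) + 1) / N, indexMinorant t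
      ≤ ∑ u ∈ Finset.Icc 1 a, indexMinorant ((u : ℝ) / N) := by
  have hN' : (0 : ℝ) < N := by exact_mod_cast hN
  -- Mathlib's comparison for the rescaled function `x ↦ m(x/N)` on `[1, 1 + a]`
  have hanti : AntitoneOn (fun x : ℝ => indexMinorant (x / N)) (Icc (1 : ℝ) (1 + a)) :=
    fun x _ y _ hxy => antitone_indexMinorant (div_le_div_of_nonneg_right hxy hN'.le)
  have h := hanti.integral_le_sum
  -- `∫_1^{1+a} m(x/N) dx = N·∫_{1/N}^{(1+a)/N} m`
  have hsub : ∫ x in (1 : ℝ)..(1 + a), indexMinorant (x / N) = (N : ℝ) * ∫ t in (1 : ℝ) / N..((a : ℝ) + 1) / N, indexMinorant t := by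
    rw [intervalIntegral.integral_comp_div _ hN'.ne', smul_eq_mul]
    congr 2
    ring
  rw [hsub] at h
  have hre := sum_range_one_add_div indexMinorant (N : ℝ) a
  calc (N : ℝ) * ∫ t in (1 : ℝ) / N..((a : ℝ) + 1) / N, indexMinorant t
      ≤ ∑ i ∈ Finset.range a, indexMinorant ((1 + (i : ℕ) : ℝ) / N) := by simpa using h
    _ = _ := hre

/-- **THE PACKAGED LOWER BOUND: `0.15772·N − 1 ≤ Σ_{u=1}^{a} m(u/N)` for `1 ≤ N ≤ 2(a+1)`** (give away the first cell
`∫_0^{1/N} m ≤ 1/N`; beyond `(a+1)/N ≥ 1/2` the integrand is nonnegative). [ours] -/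
theorem sum_indexMinorant_ge {N a : ℕ} (hN : 0 < N) (ha : N ≤ 2 * (a + 1)) :
    0.15772 * N - 1 ≤ ∑ u ∈ Finset.Icc 1 a, indexMinorant ((u : ℝ) / N) := by
  have hN' : (0 : ℝ) < N := by exact_mod_cast hN
  have hii := intervalIntegrable_indexMinorant
  have h1 := integral_le_sum_indexMinorant hN a
  have hhalf : (1 : ℝ) / 2 ≤ ((a : ℝ) + 1) / N := by
    rw [div_le_div_iff₀ (by norm_num) hN']
    have : (N : ℝ) ≤ 2 * ((a : ℝ) + 1) := by exact_mod_cast ha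
    linarith
  have e1 : ∫ t in (1 : ℝ) / N..((a : ℝ) + 1) / N, indexMinorant t
      = (∫ t in (0 : ℝ)..((a : ℝ) + 1) / N, indexMinorant t) - ∫ t in (0 : ℝ)..(1 : ℝ) / N, indexMinorant t := by
    rw [← intervalIntegral.integral_add_adjacent_intervals (hii 0 ((1 : ℝ) / N)) (hii ((1 : ℝ) / N) (((a : ℝ) + 1) / N))]
    ring
  have e2 : ∫ t in (0 : ℝ)..((a : ℝ) + 1) / N, indexMinorant t
      = (∫ t in (0 : ℝ)..(1 / 2), indexMinorant t) + ∫ t in (1 / 2 : ℝ)..((a : ℝ) + 1) / N, indexMinorant t :=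
    (intervalIntegral.integral_add_adjacent_intervals (hii 0 (1 / 2)) (hii _ _)).symm
  have h3 : 0 ≤ ∫ t in (1 / 2 : ℝ)..((a : ℝ) + 1) / N, indexMinorant t := integral_indexMinorant_nonneg hhalf
  have h4 : ∫ t in (0 : ℝ)..(1 : ℝ) / N, indexMinorant t ≤ 1 / N := integral_indexMinorant_le_self (by positivity)
  rw [integral_indexMinorant_half] at e2
  have h5 : 0.15772 * N - 1 ≤ (N : ℝ) * ∫ t in (1 : ℝ) / N..((a : ℝ) + 1) / N, indexMinorant t := by
    rw [e1, e2]
    have hone : (N : ℝ) * (1 / N) = 1 := by field_simp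
    nlinarith [mul_le_mul_of_nonneg_left h4 hN'.le, mul_nonneg hN'.le h3]
  linarith

end Riemann

end Summit.Ventures.LatticeQCDFlow.Scaling

end
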